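import Mathlib
import Summits.ValiantsHypothesis.ValiantsHypothesis.Theses.RefutationDegree
import Summits.ValiantsHypothesis.ValiantsHypothesis.Theorems.RefutationDegreeDefs
import Summits.ValiantsHypothesis.ValiantsHypothesis.Theorems.RefutationDegreeNsToSos
import Summits.ValiantsHypothesis.ValiantsHypothesis.Theorems.RefutationDegreeBeyondHessianSosStubEvenTransfer
import Literature.Computability.Complexity.HermitianSosRefutation
import Literature.Computability.Complexity.NullstellensatzRefutation
import Literature.Computability.AlgebraicComplexity.DeterminantalComplexity
import Literature.Computability.AlgebraicComplexity.HessianAtOrigin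

/-!
# Line `Sketch` for crux `RefutationDegree.BeyondHessianSos` (stmt-ValiantsHypothesis-5643) —
# lead skeleton v5 (kernel-flat lever + border slicing + Kneser; lead c1, cycle 2)

Crux: `∃ c n₀, ∀ n ≥ n₀, HasSosRef n (⌊n²/2⌋+1) (n^c)` (`beyondHessianSos_iff`, `Iff.rfl`).
By soundness a refutation exists only where Rep(n, ⌊n²/2⌋+1) is INFEASIBLE
(`dc(per_n) ≥ ⌊n²/2⌋ + 2`).  The line separates the SEMANTIC half (infeasibility) from the
SYNTACTIC half (degree), and this revision reshapes both open residues of v3: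

* odd `n`: infeasibility is LANDED (`stub_oddInfeasible`, `…PlusOne.lean`, p106237; with
  `stub_pointChoice` p104845, `stub_core` p106237): `dc(per_n) ≥ ⌈n²/2⌉ + 1`.
* even `n = p + 3`: `stub_evenTransfer` (LANDED, p103165) reduces infeasibility to "no linear
  `W ∋ y₀` inside `Z(per_n)` with `2 dim W ≥ n²`" at the Mignon–Ressayre point `y₀ = J - n E₀₀`.
  NEW (this revision): a chain of PROVABLE reductions closes this for `n ≥ 56`:
  (E1) BORDER EXPANSION `stub_borderExpansion`: for `v ∈ W` with vanishing off-corner border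
  (corner `a`, lower-right block `B`, `m = n - 1 = p + 2`), `per_n(s y₀ + v) = 0 ∀ s` reads
  `(s(1-n) + a)·P(s) + s²·P'(s) = 0`, `P(s) = per_m(sJ + B)`, forcing `a = 0` and `P = m! s^m`,
  i.e. `per_m(J + B) = m!` ("`B` lies in the `J`-nilcone": all subpermanent sums `e_k(B)` vanish);
  (E2) `stub_sliceDim`: hence `dim W ≤ dim L + 2m` for a linear space `L ⊂ Mat_m` in the nilcone;
  (E3) `stub_nilconeSlice`: `A := L ∩ PP` (`PP` = zero row- and column-sums, codim `2m - 1`) has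
  `Σ X² ≡ 0` and `Σ X³ ≡ 0` (on `PP`, `e₂ = p₂/2` and `e₃ = 2p₃/3` by inclusion–exclusion), and
  `dim L ≤ dim A + 2m - 1`;
  (E5) `stub_cubicNullBound`: a linear `A ⊂ ℂ^N` on which the power sums `p₂, p₃` vanish has
  `9 dim A ≤ 4N` — from (E6) KNESER'S THEOREM FOR COORDINATEWISE PRODUCTS (Mirandola–Zémor 2015,
  Thm 3.3: `dim ST + dim St(ST) ≥ dim S + dim T`), `stub_kneserProduct`: with `P = A∘A`,
  `A ⊥ A + P` gives `3 dim A ≤ N + dim St(P)`, and every block of the stabiliser algebra meeting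
  `supp A` has `≥ 3` points (a non-zero isotropic `p₃`-null vector has `≥ 3` non-zero entries);
  arithmetic: `2 dim W ≤ 8m²/9 + 8m - 2 < (m+1)²` once `m ≥ 54`.  ALL FIVE are provable now;
  landing them proves `dc(per_n) ≥ ⌊n²/2⌋ + 2` for every `n ≥ 55` (odd `n ≥ 3` already landed).
* degree half: `stub_weakNS` (infeasible ⇒ a Nullstellensatz refutation of SOME degree: Hilbert's
  Nullstellensatz over `ℂ` in the `(n²+1)m²` unknowns, provable now) and `stub_degreeReduction`
  (the proof-complexity content: SOME degree ⇒ degree `n^c` in Hermitian-SOS, eventually; open).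
* `stub_sosRefOfHermitian` — format bridge Literature ⇒ route (`HasSosRef`), CLOSED.

`BeyondHessianSos_of` composes everything and concludes the crux BY NAME; sorries only in `stub_*`.
(The route's dependency edge 5641 ⇒ 5643 through the landed `NsToSos`,
`BeyondHessianSos_of_BeyondHessianNs`, is kept in the separate helper file work/OfNs.lean.)
-/

set_option linter.dupNamespace false

noncomputable section

open scoped BigOperators
open MvPolynomial

namespace Summit.ValiantsHypothesis.ValiantsHypothesis.Theorems.RefutationDegreeBeyondHessianSos

open Literature.Computability.AlgebraicComplexity
open Literature.Computability.Complexity (HasHermitianSosRefutationOfDegree HasNSRefutationOfDegree)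
open Summit.ValiantsHypothesis.ValiantsHypothesis.Theses.RefutationDegree
open Summit.ValiantsHypothesis.ValiantsHypothesis.Theorems.RefutationDegree

/-- **Stub A (odd `n`) — LANDED** as `…PlusOne.lean` (p106237): for odd `n ≥ 3`, `per_n` has no
affine determinantal representation of size `⌊n²/2⌋ + 1` (`dc(per_n) ≥ ⌈n²/2⌉ + 1`).  Re-declared here
with its landed signature only because the farm has not yet built `…PlusOne`; the final skeleton
imports it instead. -/
theorem stub_oddInfeasible (n : ℕ) (hn : 3 ≤ n) (hodd : n % 2 = 1) :
    ¬ HasDetRepr (perPoly (Fin n) ℂ) (n ^ 2 / 2 + 1) := by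
  sorry

/-! ### Even `n`: border slicing at the Mignon–Ressayre point, the `J`-nilcone, Kneser -/

/-- **Stub E1 (border expansion) — provable now.** Let `v` be a matrix point of size `p + 3`
whose row `0` and column `0` vanish off the corner, with corner `a = v(0,0)` and lower-right block
`B`.  If `per_{p+3}(s • y₀ + v) = 0` for every `s` (`y₀` the Mignon–Ressayre point), then `a = 0`
and `per_{p+2}(J + B) = (p+2)!`.  (Laplace along row `0` and column `0`:
`per(s y₀ + v) = (s(1-n) + a) P(s) + s² P'(s)` with `P(s) = per(sJ + B)` of degree `m = p + 2` and
leading coefficient `m!`, `P' = Σ_j per((sJ+B) with column j := 𝟙)` by the product rule; comparing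
coefficients, `(k - m) p_k + a p_{k+1} = 0` for all `k` and `a p_0 = 0`, whence `a^{m+1} = 0` and
`P = m! s^m`.) -/
theorem stub_borderExpansion (p : ℕ) (v : Fin (p + 3) × Fin (p + 3) → ℂ)
    (hrow : ∀ j : Fin (p + 2), v (0, j.succ) = 0) (hcol : ∀ i : Fin (p + 2), v (i.succ, 0) = 0)
    (hper : ∀ s : ℂ, MvPolynomial.eval (s • mrPoint ℂ p + v) (perPoly (Fin (p + 3)) ℂ) = 0) :
    v (0, 0) = 0 ∧
      MvPolynomial.eval (fun ij : Fin (p + 2) × Fin (p + 2) => 1 + v (ij.1.succ, ij.2.succ))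
        (perPoly (Fin (p + 2)) ℂ) = (Nat.factorial (p + 2) : ℂ) := by
  sorry

/-- **Stub E2 (slice dimension count) — provable now, linear algebra.** If every element of `W`
with vanishing off-corner border has vanishing corner, then the lower-right blocks of the
border-free elements of `W` form a linear space `L` with `dim W ≤ dim L + 2(p+2)`
(`W ∩ S' ≅ L` by restriction to the block, and `codim S' = 2(p+2)`). -/
theorem stub_sliceDim (p : ℕ) (W : Submodule ℂ (Fin (p + 3) × Fin (p + 3) → ℂ))
    (hcorner : ∀ v ∈ W, (∀ j : Fin (p + 2), v (0, j.succ) = 0) →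
      (∀ i : Fin (p + 2), v (i.succ, 0) = 0) → v (0, 0) = 0) :
    ∃ L : Submodule ℂ (Fin (p + 2) × Fin (p + 2) → ℂ),
      (∀ B ∈ L, ∃ v ∈ W, (∀ j : Fin (p + 2), v (0, j.succ) = 0) ∧
        (∀ i : Fin (p + 2), v (i.succ, 0) = 0) ∧ ∀ i j : Fin (p + 2), v (i.succ, j.succ) = B (i, j)) ∧
      Module.finrank ℂ W ≤ Module.finrank ℂ L + 2 * (p + 2) := by
  sorry

/-- **Stub E3 (nilcone slice) — provable now.** Let `L` be a linear space of `m × m` complex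
matrices on which `B ↦ per(J + B)` is constantly `m!` (so `per(J + tX) = m!` for all `t` and
`X ∈ L`: every subpermanent sum `e_k(X)`, the `t^k`-coefficient up to `(m-k)!`, vanishes).  Then
`A := L ∩ PP`, `PP` the matrices with all row sums and all column sums zero (codimension `2m - 1`),
satisfies `Σ_{ij} X_{ij}² = 0` and `Σ_{ij} X_{ij}³ = 0` for every `X ∈ A` — on `PP`,
`e₂(X) = ½ Σ X²` and `e₃(X) = ⅔ Σ X³` by inclusion–exclusion over coinciding column (row) indices
— and `dim L ≤ dim A + 2m - 1`. -/
theorem stub_nilconeSlice (m : ℕ) (hm : 3 ≤ m) (L : Submodule ℂ (Fin m × Fin m → ℂ))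
    (hL : ∀ B ∈ L, MvPolynomial.eval (fun ij : Fin m × Fin m => 1 + B ij) (perPoly (Fin m) ℂ) =
      (Nat.factorial m : ℂ)) :
    ∃ A : Submodule ℂ (Fin m × Fin m → ℂ),
      (∀ X ∈ A, ∑ ij, X ij ^ 2 = 0) ∧ (∀ X ∈ A, ∑ ij, X ij ^ 3 = 0) ∧
      Module.finrank ℂ L + 1 ≤ Module.finrank ℂ A + 2 * m := by
  sorry

/-- **Stub E5 (isotropic cubic-null subspaces are small) — provable now from Kneser (stub E6,
taken here as the hypothesis `hK`).** If a linear subspace `A ⊆ ℂ^ι` satisfies `Σ_i x_i² = 0`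
and `Σ_i x_i³ = 0` for every `x ∈ A`, then `9 dim A ≤ 4 |ι|`.  Proof: restrict to the support of
`A`; polarise (`A ⊥ A`, `A ⊥ A∘A`, `𝟙 ⊥ A∘A` for the dot product); Kneser with `S = T = A` gives
`dim (A∘A) + dim St(A∘A) ≥ 2 dim A`; `A ⊆ (A + A∘A)^⊥` gives `dim A + dim (A∘A) ≤ |supp A|`; and
the stabiliser algebra `St(A∘A)` has dimension `≤ #classes`, each class inside `supp A` having
`≥ 3` elements (its indicator `1_C` lies in `St`, so `1_C ∘ A` is a non-zero isotropic
`p₃`-null space, and a non-zero vector with `Σ x² = Σ x³ = 0` has `≥ 3` non-zero entries). -/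
theorem stub_cubicNullBound
    (hK : ∀ {ι : Type} [Fintype ι] [DecidableEq ι] (S T : Submodule ℂ (ι → ℂ)),
      ∃ H : Submodule ℂ (ι → ℂ), (∀ x ∈ H, ∀ v ∈ S * T, x * v ∈ S * T) ∧
        Module.finrank ℂ S + Module.finrank ℂ T ≤
          Module.finrank ℂ ↥(S * T) + Module.finrank ℂ H)
    {ι : Type} [Fintype ι] [DecidableEq ι] (A : Submodule ℂ (ι → ℂ))
    (h2 : ∀ x ∈ A, ∑ i, x i ^ 2 = 0) (h3 : ∀ x ∈ A, ∑ i, x i ^ 3 = 0) :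
    9 * Module.finrank ℂ A ≤ 4 * Fintype.card ι := by
  sorry

/-- **Stub E6 (Kneser's theorem for coordinatewise products; Mirandola–Zémor 2015, Thm 3.3) —
provable now (1½ pages: an `e`-transform induction over an infinite field plus a pigeonhole over
the finitely many subalgebras of `K^n`).**  For linear subspaces `S, T ⊆ ℂ^ι` and their
coordinatewise product `S * T = span {s * t}`: `dim (S*T) + dim St(S*T) ≥ dim S + dim T`, where
`St(V) = {x : x * V ⊆ V}`; stated with a witness `H ⊆ St(S * T)`. -/
theorem stub_kneserProduct {ι : Type} [Fintype ι] [DecidableEq ι] (S T : Submodule ℂ (ι → ℂ)) :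
    ∃ H : Submodule ℂ (ι → ℂ), (∀ x ∈ H, ∀ v ∈ S * T, x * v ∈ S * T) ∧
      Module.finrank ℂ S + Module.finrank ℂ T ≤
        Module.finrank ℂ ↥(S * T) + Module.finrank ℂ H := by
  sorry

/-- Flats through the Mignon–Ressayre point are small, eventually (glue of stubs E1, E2, E3, E5,
E6): for `p + 2 ≥ 54`, every linear `W ∋ y₀` inside `Z(per_{p+3})` has `2 dim W < (p+3)²`. -/
theorem noHalfFlat :
    ∃ n₀ : ℕ, ∀ p : ℕ, n₀ ≤ p + 3 → (p + 3) % 2 = 0 →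
      ∀ W : Submodule ℂ (Fin (p + 3) × Fin (p + 3) → ℂ), mrPoint ℂ p ∈ W →
        (∀ w ∈ W, MvPolynomial.eval w (perPoly (Fin (p + 3)) ℂ) = 0) →
        2 * Module.finrank ℂ W < (p + 3) ^ 2 := by
  refine ⟨55, fun p hp _heven W hy hZ => ?_⟩
  -- border-free elements of `W`: `per(s y₀ + v) = 0` for all `s`
  have hline : ∀ v ∈ W, ∀ s : ℂ,
      MvPolynomial.eval (s • mrPoint ℂ p + v) (perPoly (Fin (p + 3)) ℂ) = 0 :=
    fun v hv s => hZ _ (W.add_mem (W.smul_mem s hy) hv)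
  have hcorner : ∀ v ∈ W, (∀ j : Fin (p + 2), v (0, j.succ) = 0) →
      (∀ i : Fin (p + 2), v (i.succ, 0) = 0) → v (0, 0) = 0 :=
    fun v hv hr hc => (stub_borderExpansion p v hr hc (hline v hv)).1
  obtain ⟨L, hL, hdimW⟩ := stub_sliceDim p W hcorner
  -- the blocks lie in the `J`-nilcone
  have hnil : ∀ B ∈ L, MvPolynomial.eval (fun ij : Fin (p + 2) × Fin (p + 2) => 1 + B ij)
      (perPoly (Fin (p + 2)) ℂ) = (Nat.factorial (p + 2) : ℂ) := by
    intro B hB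
    obtain ⟨v, hv, hr, hc, hblock⟩ := hL B hB
    have h2 := (stub_borderExpansion p v hr hc (hline v hv)).2
    have hfun : (fun ij : Fin (p + 2) × Fin (p + 2) => 1 + v (ij.1.succ, ij.2.succ)) =
        fun ij : Fin (p + 2) × Fin (p + 2) => 1 + B ij := by
      funext ij
      obtain ⟨i, j⟩ := ij
      rw [hblock i j]
    rw [hfun] at h2
    exact h2
  -- slice by `PP`, then the Kneser bound
  obtain ⟨A, hA2, hA3, hdimL⟩ := stub_nilconeSlice (p + 2) (by omega) L hnil
  have hA := stub_cubicNullBound stub_kneserProduct A hA2 hA3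
  rw [Fintype.card_prod, Fintype.card_fin] at hA
  -- arithmetic: 18 dim W ≤ 18 dim A + 72(p+2) - 18 ≤ 8(p+2)² + 72(p+2) - 18 < 9(p+3)² for p+2 ≥ 54
  have hp2 : 54 ≤ p + 2 := by omega
  have hsq : (p + 2) * (p + 2) ≥ 54 * (p + 2) := Nat.mul_le_mul_right _ hp2
  nlinarith [hdimW, hdimL, hA, hsq]

/-- Semantic half for even `n`, eventually (from `stub_evenTransfer`, landed, and `noHalfFlat`). -/
theorem evenInfeasible :
    ∃ n₀ : ℕ, ∀ n ≥ n₀, n % 2 = 0 → ¬ HasDetRepr (perPoly (Fin n) ℂ) (n ^ 2 / 2 + 1) := by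
  obtain ⟨n₀, h⟩ := noHalfFlat
  refine ⟨max n₀ 3, fun n hn heven => ?_⟩
  obtain ⟨p, rfl⟩ : ∃ p, n = p + 3 := ⟨n - 3, by omega⟩
  exact stub_evenTransfer p heven (h p (le_trans (le_max_left _ _) hn) heven)

/-! ### The degree half -/

/-- **Stub C1 (weak Nullstellensatz for Rep) — provable now.** If `per_n` has no affine
determinantal representation of size `m`, the coefficient system of the defect
`det(pencil) - per_n` has a Nullstellensatz refutation of SOME degree: a common zero `a` of the
coefficients would make `pencil(a)` a representation (`RefutationDegreeSosSound.mapMatrix_eval_pencil`),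
so the zero locus is empty and `1` lies in the ideal (Hilbert's Nullstellensatz,
`MvPolynomial.vanishingIdeal_zeroLocus_eq_radical`, `ℂ` algebraically closed, finitely many
unknowns); a finite combination `1 = Σ h_μ · coeff_μ` is a refutation of degree `max deg`. -/
theorem stub_weakNS (n m : ℕ) (h : ¬ HasDetRepr (perPoly (Fin n) ℂ) m) :
    ∃ d : ℕ, HasNSRefutationOfDegree
      (fun μ : (Fin n × Fin n) →₀ ℕ => (defect n m).coeff μ) d := by
  sorry

/-- **Stub C2 (degree reduction) — OPEN, hardest; the proof-complexity content of the crux.**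
Eventually in `n`: if the coefficient system of Rep(n, ⌊n²/2⌋+1) has a Nullstellensatz refutation
of some degree, it has a Hermitian-SOS refutation with every product of degree `≤ n^c`.
(Generic bounds are Kollár-type `m^{O((n²+1)m²)}`; the known infeasibility proof for odd `n` —
kernel flat, regularity `rank A(0) = m - 1`, isotropy — is an identity argument except for the
regularity step, a dimension count, and the point choice, a disjunction; a poly(n)-degree
Positivstellensatz simulation of these two steps is the concrete open problem.  Dies if the
route's `RefutationBarrier` holds.) -/
theorem stub_degreeReduction :
    ∃ c n₀ : ℕ, ∀ n ≥ n₀,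
      (∃ d : ℕ, HasNSRefutationOfDegree
        (fun μ : (Fin n × Fin n) →₀ ℕ => (defect n (n ^ 2 / 2 + 1)).coeff μ) d) →
      HasHermitianSosRefutationOfDegree
        (fun μ : (Fin n × Fin n) →₀ ℕ => (defect n (n ^ 2 / 2 + 1)).coeff μ) (n ^ c) := by
  sorry

/-- The degree half (glue of stubs C1, C2): eventually in `n`, infeasibility of
Rep(n, ⌊n²/2⌋+1) yields a Hermitian-SOS refutation of degree `≤ n^c` of its equations. -/
theorem hermitianSosOfInfeasible :
    ∃ c n₀ : ℕ, ∀ n ≥ n₀, ¬ HasDetRepr (perPoly (Fin n) ℂ) (n ^ 2 / 2 + 1) →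
      HasHermitianSosRefutationOfDegree
        (fun μ : (Fin n × Fin n) →₀ ℕ => (defect n (n ^ 2 / 2 + 1)).coeff μ) (n ^ c) := by
  obtain ⟨c, n₀, hC⟩ := stub_degreeReduction
  exact ⟨c, n₀, fun n hn hinf => hC n hn (stub_weakNS n _ hinf)⟩

/-- **Stub D (format bridge) — CLOSED.** A Hermitian-SOS refutation of the equations of Rep(n,m)
in the Literature format is one in the route's inlined format `HasSosRef n m d`
(`exists_sos_certificate_support_of_hasHermitianSosRefutationOfDegree_coeff`, landed with item
`NsToSos`, at `P = defect n m`). -/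
theorem stub_sosRefOfHermitian (n m d : ℕ)
    (h : HasHermitianSosRefutationOfDegree
      (fun μ : (Fin n × Fin n) →₀ ℕ => (defect n m).coeff μ) d) :
    HasSosRef n m d :=
  exists_sos_certificate_support_of_hasHermitianSosRefutationOfDegree_coeff (defect n m) d h

/-! ### Composition -/

/-- **Composition.** The stubs give the crux `BeyondHessianSos` by name: unfold it to
`∃ c n₀, ∀ n ≥ n₀, HasSosRef n (⌊n²/2⌋+1) (n^c)` (`beyondHessianSos_iff`), take `c` from the degree
half and `n₀` past the thresholds of the even case, the degree half and `3`; infeasibility comes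
from `stub_oddInfeasible` (landed; odd `n`) or `evenInfeasible` (even `n`), the certificate from
`hermitianSosOfInfeasible`, its route format from `stub_sosRefOfHermitian`. -/
theorem BeyondHessianSos_of : BeyondHessianSos := by
  rw [beyondHessianSos_iff]
  obtain ⟨c, n₀, hC⟩ := hermitianSosOfInfeasible
  obtain ⟨n₁, hB⟩ := evenInfeasible
  refine ⟨c, max (max n₀ n₁) 3, fun n hn => ?_⟩
  have hn₀ : n₀ ≤ n := le_trans (le_trans (le_max_left _ _) (le_max_left _ _)) hn
  have hn₁ : n₁ ≤ n := le_trans (le_trans (le_max_right _ _) (le_max_left _ _)) hn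
  have hn3 : 3 ≤ n := le_trans (le_max_right _ _) hn
  have hinf : ¬ HasDetRepr (perPoly (Fin n) ℂ) (n ^ 2 / 2 + 1) := by
    rcases Nat.mod_two_eq_zero_or_one n with h | h
    · exact hB n hn₁ h
    · exact stub_oddInfeasible n hn3 h
  exact stub_sosRefOfHermitian n _ _ (hC n hn₀ hinf)

end Summit.ValiantsHypothesis.ValiantsHypothesis.Theorems.RefutationDegreeBeyondHessianSos

end
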